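import Literature.Computability.QuantumComplexity.PauliParseval
import Mathlib.Analysis.MeanInequalitiesPow

/-!
# Pauli moments of a pure state and the stabilizer-fidelity ceilings they certify

Objects and inequalities over the vocabulary of `PauliExpansion.lean` / `PauliParseval.lean`
(registers `Fin n → Bool`, Pauli words `Fin n → Pauli`, `pauliString`, `pauliCoeff`), namespace
`Literature.Computability.QuantumComplexity.PauliMoments`:

* §1 objects: `braket`, `normSq`, `proj ψ = |ψ⟩⟨ψ|`, the Pauli expectations `a_S(ψ) = Tr(σ_S |ψ⟩⟨ψ|)`
  (`pauliExp`), the `2k`-th PAULI MOMENTS `W_k(ψ) = 2⁻ⁿ Σ_S |a_S(ψ)|^{2k}` (`moment`; `k = 2` is the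
  stabilizer purity, `M₂ = −log₂ W₂` the stabilizer 2-Rényi entropy [LeoneOlivieroHamma2021]), and a
  STABILIZER FRAME of a state `s` (`StabFrame s`: `2ⁿ` distinct Pauli words `w(T)`, signs `|ε_T| ≤ 1`,
  `|s⟩⟨s| = 2⁻ⁿ Σ_T ε_T σ_{w(T)}` — the projector onto a stabilizer state as the average of its stabilizer
  group [NielsenChuang2010, §10.5.1; AaronsonGottesman2004, §II]);
* §2 (T1) the per-frame ceiling `|⟨s|ψ⟩|^{4k} ≤ W_k(ψ)` [HaugPiroli2023, §4: `M_n ≤ 2n/(n−1)·D_min`, same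
  convexity argument] and the sup-certificate `|⟨s|ψ⟩|² ≤ (|a_I(ψ)| + (2ⁿ−1)·m)/2ⁿ` whenever `|a_S(ψ)| ≤ m`
  off the identity;
* §3 (T0) the class ceiling `|⟨φ|ψ⟩|^{4k} ≤ ‖c‖₁^{4k} · W_k(ψ)` for frame superpositions `φ = Σᵢ cᵢ tᵢ`
  (the dual-witness inequality `ξ(φ) ≥ 1/F(φ)` of [BravyiEtAl2019, §2 Def. 3–4, §5.1] read from the
  stabilizer fidelity to the Pauli moments; `‖c‖₁²` is the weight whose minimum is the stabilizer extent);
* §6 non-vacuity: the computational frame `{Z^T}` of `|0ⁿ⟩` inhabits `StabFrame` (`zeroFrame`).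

The sequel `PauliMomentCaps.lean` proves the universal LOWER bounds on `W_k` and on the sup-certificate
(Parseval caps), i.e. what these certificates can never certify.

## References

* [HaugPiroli2023] T. Haug, L. Piroli, Quantum 7 (2023) 1092; arXiv:2303.10152, §4.
* [LeoneOlivieroHamma2021] L. Leone, S. F. E. Oliviero, A. Hamma, Phys. Rev. Lett. 128 (2022) 050402;
  arXiv:2106.12587, eq. (1)–(2).
* [BravyiEtAl2019] S. Bravyi, D. Browne, P. Calpin, E. Campbell, D. Gosset, M. Howard, Quantum 3 (2019)
  181; arXiv:1808.00128, §2, §5.1.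
* [NielsenChuang2010] M. A. Nielsen, I. L. Chuang, CUP 2010, §10.5.1. [AaronsonGottesman2004] S. Aaronson,
  D. Gottesman, Phys. Rev. A 70 (2004) 052328, §II. [KempeEtAl2010] Quantum Inf. Comput. 10 (2010) 361, §2.
-/

noncomputable section

open Matrix Finset Literature.Computability.QuantumComplexity

namespace Literature.Computability.QuantumComplexity.PauliMoments

/-! ### §1 Objects -/

/-- Computational-basis labels of an `n`-qubit register. [folklore] -/
abbrev Reg (n : ℕ) : Type := Fin n → Bool

/-- Pauli words on `n` qubits. [folklore] -/
abbrev PWord (n : ℕ) : Type := Fin n → Pauli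

variable {n : ℕ}

/-- The inner product `⟨φ|ψ⟩ = Σ_x conj(φ x) ψ x`. [folklore] -/
def braket (φ ψ : Reg n → ℂ) : ℂ := ∑ x, star (φ x) * ψ x

/-- The squared norm `‖ψ‖² = Σ_x |ψ x|²`. [folklore] -/
def normSq (ψ : Reg n → ℂ) : ℝ := ∑ x, ‖ψ x‖ ^ 2

/-- The rank-one matrix `|ψ⟩⟨ψ|`. [folklore] -/
def proj (ψ : Reg n → ℂ) : Matrix (Reg n) (Reg n) ℂ := Matrix.of fun x y => ψ x * star (ψ y)

/-- The Pauli expectation `a_S(ψ) = Tr(σ_S |ψ⟩⟨ψ|) = ⟨ψ|σ_S|ψ⟩`. [folklore] -/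
def pauliExp (ψ : Reg n → ℂ) (S : PWord n) : ℂ := pauliCoeff (proj ψ) S

/-- The identity word. [folklore] -/
def idWord (n : ℕ) : PWord n := fun _ => Pauli.I

/-- The `2k`-th Pauli moment `W_k(ψ) = 2⁻ⁿ Σ_S |a_S(ψ)|^{2k}` (`k = 2`: stabilizer purity
`2⁻ⁿ Σ_P ⟨ψ|P|ψ⟩⁴`, `M₂(ψ) = −log₂ W₂(ψ)`). [cite: LeoneOlivieroHamma2021, eq. (1)–(2)] -/
def moment (k : ℕ) (ψ : Reg n → ℂ) : ℝ := (∑ S : PWord n, ‖pauliExp ψ S‖ ^ (2 * k)) / 2 ^ n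

/-- A STABILIZER FRAME of `s`: `2ⁿ` pairwise distinct Pauli words `w(T)` with bounded signs `ε_T`,
`w(0ⁿ) = I`, and `|s⟩⟨s| = 2⁻ⁿ Σ_T ε_T σ_{w(T)}` — the projector onto a stabilizer state as the
average of its stabilizer group. CLASS (two-line check): taking the trace gives
`‖s‖² = ε_0`, and Hilbert–Schmidt orthogonality of distinct Pauli words gives `‖s‖⁴ = Tr(|s⟩⟨s|)² =
2⁻ⁿ Σ_T |ε_T|² ≤ 1`; hence a UNIT vector with a `StabFrame` has `|ε_T| = 1` on `2ⁿ` distinct words and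
is a stabilizer state (conversely every stabilizer state has such a frame), while sub-normalised multiples
and `0` also carry frames — harmless for the CEILINGS below, which are the only use. The Lean bridge from
the tree's operational `stabilizerStates n` is not typed here (support, not claimed).
[cite: NielsenChuang2010, §10.5.1 eq. (10.88); AaronsonGottesman2004, §II] -/
structure StabFrame (s : Reg n → ℂ) where
  /-- the words of the group elements, indexed by `n`-bit labels -/
  word : Reg n → PWord n
  /-- the signs (phases) of the group elements -/
  sign : Reg n → ℂ
  /-- distinct labels give distinct words -/
  word_injective : Function.Injective word
  /-- the trivial label is the identity word -/
  word_zero : word (fun _ => false) = idWord n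
  /-- signs are bounded by one in modulus -/
  norm_sign_le : ∀ T, ‖sign T‖ ≤ 1
  /-- the frame identity `|s⟩⟨s| = 2⁻ⁿ Σ_T ε_T σ_{w(T)}`, entrywise -/
  frame : ∀ x y, s x * star (s y) = (∑ T, sign T * pauliString (word T) x y) / 2 ^ n

/-! ### Basic identities -/

/-- `|Reg n| = 2ⁿ` (the `n`-qubit computational basis). [cite: NielsenChuang2010, §10.5.1] -/
theorem card_reg : Fintype.card (Reg n) = 2 ^ n := by
  simp

/-- `|PWord n| = 4ⁿ` (Pauli words up to phase). [cite: NielsenChuang2010, §10.5.1] -/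
theorem card_pword : Fintype.card (PWord n) = 4 ^ n := by
  simp [Pauli.card_univ]

/-- Unfolding of `a_S(ψ) = Tr(σ_S|ψ⟩⟨ψ|)` as a double sum `Σ_y Σ_x (σ_S)_{yx} ψ_x conj(ψ_y)` (the Pauli
expansion coefficient of a rank-one operator). [cite: KempeEtAl2010, §2] -/
theorem pauliExp_eq (ψ : Reg n → ℂ) (S : PWord n) :
    pauliExp ψ S = ∑ y, ∑ x, pauliString S y x * (ψ x * star (ψ y)) := by
  unfold pauliExp
  rw [pauliCoeff_eq, Matrix.trace]
  simp only [Matrix.diag_apply, Matrix.mul_apply, proj, Matrix.of_apply]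

/-- The identity coefficient is the squared norm: `a_I(ψ) = Tr |ψ⟩⟨ψ| = ‖ψ‖²`. [cite: KempeEtAl2010, §2] -/
theorem pauliExp_idWord (ψ : Reg n → ℂ) : pauliExp ψ (idWord n) = (normSq ψ : ℂ) := by
  unfold pauliExp idWord normSq
  rw [pauliCoeff_const_I, Matrix.trace]
  simp only [Matrix.diag_apply, proj, Matrix.of_apply, Complex.star_def, Complex.mul_conj,
    Complex.normSq_eq_norm_sq]
  push_cast
  rfl

/-- Parseval for pure states: `Σ_S |a_S(ψ)|² = 2ⁿ ‖ψ‖⁴`. [cite: KempeEtAl2010, §2] -/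
theorem sum_norm_pauliExp_sq (ψ : Reg n → ℂ) :
    ∑ S : PWord n, ‖pauliExp ψ S‖ ^ 2 = 2 ^ n * normSq ψ ^ 2 := by
  unfold pauliExp
  rw [sum_norm_pauliCoeff_sq, Fintype.card_fin]
  congr 1
  simp only [proj, Matrix.of_apply, norm_mul, norm_star, mul_pow, normSq, sq (∑ x, ‖ψ x‖ ^ 2),
    Finset.sum_mul_sum]

/-! ### §2 (T1) Per-frame ceilings -/

variable {s : Reg n → ℂ}

/-- The frame identity `2ⁿ|s⟩⟨s| = Σ_T ε_T σ_{w(T)}` (cleared of its denominator).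
[cite: NielsenChuang2010, §10.5.1] -/
theorem StabFrame.sum_sign_mul (F : StabFrame s) (y x : Reg n) :
    ∑ T, F.sign T * pauliString (F.word T) y x = 2 ^ n * (s y * star (s x)) := by
  have h2 : (2 : ℂ) ^ n ≠ 0 := pow_ne_zero _ two_ne_zero
  rw [F.frame y x]
  field_simp

/-- `|⟨s|ψ⟩|² = ⟨ψ| (2⁻ⁿ Σ_T ε_T σ_{w(T)}) |ψ⟩ = 2⁻ⁿ Σ_T ε_T a_{w(T)}(ψ)`, as complex numbers.
[cite: NielsenChuang2010, §10.5.1] -/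
theorem StabFrame.braket_mul_star (F : StabFrame s) (ψ : Reg n → ℂ) :
    braket s ψ * star (braket s ψ) = (∑ T, F.sign T * pauliExp ψ (F.word T)) / 2 ^ n := by
  have h2 : (2 : ℂ) ^ n ≠ 0 := pow_ne_zero _ two_ne_zero
  rw [eq_div_iff h2]
  -- right-hand side as a triple sum
  have hR : ∑ T, F.sign T * pauliExp ψ (F.word T) =
      ∑ y, ∑ x, 2 ^ n * (s y * star (s x)) * (ψ x * star (ψ y)) := by
    have step : ∀ T, F.sign T * pauliExp ψ (F.word T) =
        ∑ y, ∑ x, F.sign T * pauliString (F.word T) y x * (ψ x * star (ψ y)) := by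
      intro T
      rw [pauliExp_eq, Finset.mul_sum]
      refine Finset.sum_congr rfl fun y _ => ?_
      rw [Finset.mul_sum]
      refine Finset.sum_congr rfl fun x _ => ?_
      ring
    simp_rw [step]
    rw [Finset.sum_comm]
    refine Finset.sum_congr rfl fun y _ => ?_
    rw [Finset.sum_comm]
    refine Finset.sum_congr rfl fun x _ => ?_
    rw [← Finset.sum_mul, F.sum_sign_mul y x]
  -- left-hand side as the same sum
  have hL : braket s ψ * star (braket s ψ) * 2 ^ n =
      ∑ y, ∑ x, 2 ^ n * (s y * star (s x)) * (ψ x * star (ψ y)) := by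
    have hs : star (braket s ψ) = ∑ y, s y * star (ψ y) := by
      unfold braket
      rw [star_sum]
      refine Finset.sum_congr rfl fun y _ => ?_
      rw [star_mul', star_star, mul_comm]
    rw [hs, braket, Finset.sum_mul_sum, Finset.sum_mul, Finset.sum_comm]
    refine Finset.sum_congr rfl fun y _ => ?_
    rw [Finset.sum_mul]
    refine Finset.sum_congr rfl fun x _ => ?_
    ring
  rw [hL, hR]

/-- The frame bound `|⟨s|ψ⟩|² ≤ 2⁻ⁿ Σ_T |a_{w(T)}(ψ)|`. [cite: NielsenChuang2010, §10.5.1] -/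
theorem StabFrame.fidelity_le_avg (F : StabFrame s) (ψ : Reg n → ℂ) :
    ‖braket s ψ‖ ^ 2 ≤ (∑ T, ‖pauliExp ψ (F.word T)‖) / 2 ^ n := by
  have h : ‖braket s ψ‖ ^ 2 = ‖(∑ T, F.sign T * pauliExp ψ (F.word T)) / 2 ^ n‖ := by
    rw [← F.braket_mul_star ψ, norm_mul, norm_star, sq]
  rw [h, norm_div, norm_pow, Complex.norm_two]
  gcongr
  calc ‖∑ T, F.sign T * pauliExp ψ (F.word T)‖
      ≤ ∑ T, ‖F.sign T * pauliExp ψ (F.word T)‖ := norm_sum_le _ _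
    _ ≤ ∑ T, ‖pauliExp ψ (F.word T)‖ := by
        refine Finset.sum_le_sum fun T _ => ?_
        rw [norm_mul]
        exact mul_le_of_le_one_left (norm_nonneg _) (F.norm_sign_le T)

/-- Reindexing a sum of non-negative terms along the injective word map only loses terms.
(Plumbing for the frame-to-moment step.) [cite: NielsenChuang2010, §10.5.1] -/
theorem StabFrame.sum_word_le (F : StabFrame s) (g : PWord n → ℝ) (hg : ∀ S, 0 ≤ g S) :
    ∑ T, g (F.word T) ≤ ∑ S, g S := by
  have h : ∑ T, g (F.word T) = ∑ S ∈ (Finset.univ : Finset (Reg n)).map ⟨F.word, F.word_injective⟩, g S := by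
    rw [Finset.sum_map]
    rfl
  rw [h]
  exact Finset.sum_le_sum_of_subset_of_nonneg (Finset.subset_univ _) fun S _ _ => hg S

/-- **(T1) frame ceiling by Pauli moments**: `(|⟨s|ψ⟩|²)^{2k} ≤ W_k(ψ)` for every stabilizer frame
and every vector `ψ` (power mean over the `2ⁿ` frame words, then enlarge to all `4ⁿ` words).
[cite: HaugPiroli2023, §II (stabilizer fidelity vs stabilizer entropies)] -/
theorem StabFrame.fidelity_pow_le_moment (F : StabFrame s) (ψ : Reg n → ℂ) (k : ℕ) :
    (‖braket s ψ‖ ^ 2) ^ (2 * k) ≤ moment k ψ := by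
  have hw : ∑ _T : Reg n, (1 : ℝ) / 2 ^ n = 1 := by
    rw [Finset.sum_const, Finset.card_univ, card_reg, nsmul_eq_mul]
    push_cast
    field_simp
  have h1 : ‖braket s ψ‖ ^ 2 ≤ ∑ T, (1 : ℝ) / 2 ^ n * ‖pauliExp ψ (F.word T)‖ := by
    rw [← Finset.mul_sum, one_div_mul_eq_div]  -- (Σ)/2^n
    exact F.fidelity_le_avg ψ
  calc (‖braket s ψ‖ ^ 2) ^ (2 * k)
      ≤ (∑ T, (1 : ℝ) / 2 ^ n * ‖pauliExp ψ (F.word T)‖) ^ (2 * k) :=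
        pow_le_pow_left₀ (by positivity) h1 _
    _ ≤ ∑ T, (1 : ℝ) / 2 ^ n * ‖pauliExp ψ (F.word T)‖ ^ (2 * k) :=
        Real.pow_arith_mean_le_arith_mean_pow Finset.univ _ _ (fun _ _ => by positivity) hw
          (fun _ _ => norm_nonneg _) _
    _ = (∑ T, ‖pauliExp ψ (F.word T)‖ ^ (2 * k)) / 2 ^ n := by
        rw [← Finset.mul_sum, one_div_mul_eq_div]
    _ ≤ moment k ψ := by
        unfold moment
        gcongr
        exact F.sum_word_le (fun S => ‖pauliExp ψ S‖ ^ (2 * k)) fun S => by positivity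

/-- **(T1') frame ceiling by the sup-certificate**: if `|a_S(ψ)| ≤ m` for every non-identity word
then `|⟨s|ψ⟩|² ≤ (|a_I(ψ)| + (2ⁿ − 1)·m)/2ⁿ` — one line from the frame average
`|⟨s|ψ⟩|² = 2⁻ⁿ Σ_T ε_T a_{w(T)}(ψ)`. Arithmetic on [cite: NielsenChuang2010, §10.5.1]. -/
theorem StabFrame.fidelity_le_supCert (F : StabFrame s) (ψ : Reg n → ℂ) (m : ℝ)
    (hm : ∀ S, S ≠ idWord n → ‖pauliExp ψ S‖ ≤ m) :
    ‖braket s ψ‖ ^ 2 ≤ (‖pauliExp ψ (idWord n)‖ + (2 ^ n - 1) * m) / 2 ^ n := by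
  refine le_trans (F.fidelity_le_avg ψ) ?_
  gcongr
  set z : Reg n := fun _ => false
  rw [← Finset.add_sum_erase _ _ (Finset.mem_univ z), F.word_zero]
  gcongr
  have hcard : ((Finset.univ.erase z).card : ℝ) = 2 ^ n - 1 := by
    rw [Finset.card_erase_of_mem (Finset.mem_univ z), Finset.card_univ, card_reg,
      Nat.cast_sub Nat.one_le_two_pow]
    push_cast
    ring
  calc ∑ T ∈ Finset.univ.erase z, ‖pauliExp ψ (F.word T)‖
      ≤ ∑ _T ∈ Finset.univ.erase z, m := by
        refine Finset.sum_le_sum fun T hT => hm _ fun h => ?_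
        rw [← F.word_zero] at h
        exact (Finset.mem_erase.1 hT).1 (F.word_injective h)
    _ = (2 ^ n - 1) * m := by rw [Finset.sum_const, nsmul_eq_mul, hcard]

/-! ### §3 (T0) Ceiling for the named class: frame superpositions of weight `‖c‖₁` -/

/-- Linearity of `⟨φ|ψ⟩` in the bra over a finite superposition `φ = Σᵢ cᵢ tᵢ` (the triangle-inequality
step `|Σⱼ cⱼ⟨ψ|φⱼ⟩| ≤ ‖c‖₁ √F` starts here). [cite: BravyiEtAl2019, §5.1] -/
theorem braket_sum_mul {r : ℕ} (c : Fin r → ℂ) (t : Fin r → Reg n → ℂ) (ψ : Reg n → ℂ) :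
    braket (fun x => ∑ i, c i * t i x) ψ = ∑ i, star (c i) * braket (t i) ψ := by
  unfold braket
  simp_rw [star_sum, star_mul', Finset.sum_mul, Finset.mul_sum]
  rw [Finset.sum_comm]
  refine Finset.sum_congr rfl fun i _ => Finset.sum_congr rfl fun x _ => ?_
  ring

/-- **(T0) class ceiling**: for `φ = Σᵢ cᵢ tᵢ` with every `tᵢ` carrying a stabilizer frame,
`|⟨φ|ψ⟩|^{4k} ≤ (Σᵢ |cᵢ|)^{4k} · W_k(ψ)`; with `‖c‖₁² ≤ Ξ` and `k = 2` this is the fidelity ceiling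
`|⟨φ|ψ⟩|² ≤ Ξ · W₂(ψ)^{1/4}` of the extent-`Ξ` class. [cite: BravyiEtAl2019, §2 (ξ, F)] -/
theorem superposition_ceiling {r : ℕ} (c : Fin r → ℂ) (t : Fin r → Reg n → ℂ)
    (F : ∀ i, StabFrame (t i)) (ψ : Reg n → ℂ) (k : ℕ) :
    ‖braket (fun x => ∑ i, c i * t i x) ψ‖ ^ (4 * k) ≤ (∑ i, ‖c i‖) ^ (4 * k) * moment k ψ := by
  rcases Nat.eq_zero_or_pos k with hk | hk
  · subst hk
    have hm : (1 : ℝ) ≤ moment 0 ψ := by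
      unfold moment
      simp only [mul_zero, pow_zero, Finset.sum_const, Finset.card_univ, card_pword, nsmul_eq_mul,
        mul_one]
      rw [le_div_iff₀ (by positivity), one_mul]
      exact_mod_cast pow_le_pow_left₀ (by norm_num : (0 : ℝ) ≤ 2) (by norm_num : (2 : ℝ) ≤ 4) n
    simpa using hm
  rcases Nat.eq_zero_or_pos r with hr | hr
  · subst hr
    have h0 : braket (fun x => ∑ i : Fin 0, c i * t i x) ψ = 0 := by simp [braket]
    rw [h0, norm_zero, zero_pow (by omega)]
    exact mul_nonneg (pow_nonneg (Finset.sum_nonneg fun i _ => norm_nonneg _) _)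
      (div_nonneg (Finset.sum_nonneg fun S _ => pow_nonneg (norm_nonneg _) _) (by positivity))
  haveI : Nonempty (Fin r) := ⟨⟨0, hr⟩⟩
  obtain ⟨j, -, hj⟩ := Finset.exists_max_image Finset.univ (fun i => ‖braket (t i) ψ‖)
    Finset.univ_nonempty
  have hlin : ‖braket (fun x => ∑ i, c i * t i x) ψ‖ ≤ (∑ i, ‖c i‖) * ‖braket (t j) ψ‖ := by
    rw [braket_sum_mul, Finset.sum_mul]
    refine le_trans (norm_sum_le _ _) (Finset.sum_le_sum fun i _ => ?_)
    rw [norm_mul, norm_star]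
    exact mul_le_mul_of_nonneg_left (hj i (Finset.mem_univ i)) (norm_nonneg _)
  calc ‖braket (fun x => ∑ i, c i * t i x) ψ‖ ^ (4 * k)
      ≤ ((∑ i, ‖c i‖) * ‖braket (t j) ψ‖) ^ (4 * k) := pow_le_pow_left₀ (norm_nonneg _) hlin _
    _ = (∑ i, ‖c i‖) ^ (4 * k) * (‖braket (t j) ψ‖ ^ 2) ^ (2 * k) := by
        rw [mul_pow, ← pow_mul]; ring_nf
    _ ≤ (∑ i, ‖c i‖) ^ (4 * k) * moment k ψ :=
        mul_le_mul_of_nonneg_left ((F j).fidelity_pow_le_moment ψ k)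
          (pow_nonneg (Finset.sum_nonneg fun i _ => norm_nonneg _) _)

/-! ### §6 Non-vacuity: the computational frame of `|0ⁿ⟩` -/

/-- `|0ⁿ⟩`. [folklore] -/
def zeroKet (n : ℕ) : Reg n → ℂ := fun x => if x = fun _ => false then 1 else 0

/-- The `Z`-type word `Z^T = ⊗ᵢ Z^{Tᵢ}`. [folklore] -/
def zWord (T : Reg n) : PWord n := fun i => if T i then Pauli.Z else Pauli.I

/-- `T ↦ Z^T` is injective (the `2ⁿ` elements of the stabilizer `⟨Z₁,…,Z_n⟩` of `|0ⁿ⟩` are distinct).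
[cite: NielsenChuang2010, §10.5.1] -/
theorem zWord_injective : Function.Injective (zWord (n := n)) := by
  intro T T' h
  funext i
  have hi := congrFun h i
  simp only [zWord] at hi
  cases hT : T i <;> cases hT' : T' i <;> simp_all

/-- Entries of `Z^T`: diagonal, with `(Z^T)_{xx} = (−1)^{|T ∧ x|}`. [cite: NielsenChuang2010, §10.5.1] -/
theorem pauliString_zWord_apply (T x y : Reg n) :
    pauliString (zWord T) x y =
      ∏ i, (if x i = y i then (if T i = true then (if x i = true then (-1 : ℂ) else 1) else 1)
        else 0) := by
  rw [pauliString_eq, tensorAll_apply]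
  refine Finset.prod_congr rfl fun i _ => ?_
  unfold zWord
  cases T i <;> cases x i <;> cases y i <;> simp

/-- `Σ_T (Z^T)_{xy} = 2ⁿ [x = y = 0ⁿ]`, i.e. `2⁻ⁿ Σ_T Z^T = |0ⁿ⟩⟨0ⁿ|` (the stabilizer-group average is the
projector). [cite: NielsenChuang2010, §10.5.1] -/
theorem sum_pauliString_zWord (x y : Reg n) :
    ∑ T, pauliString (zWord T) x y =
      if x = (fun _ => false) ∧ y = (fun _ => false) then (2 : ℂ) ^ n else 0 := by
  simp_rw [pauliString_zWord_apply]
  rw [← Fintype.prod_sum fun i (b : Bool) =>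
    (if x i = y i then (if b = true then (if x i = true then (-1 : ℂ) else 1) else 1) else 0)]
  simp only [Fintype.sum_bool, if_true, Bool.false_eq_true, if_false]
  by_cases hx : x = fun _ => false
  · subst hx
    by_cases hy : y = fun _ => false
    · subst hy
      simp [Finset.prod_const, Finset.card_univ]
      norm_num
    · rw [if_neg (fun h => hy h.2)]
      obtain ⟨i, hi⟩ : ∃ i, y i = true := by
        by_contra hc
        push Not at hc
        exact hy (funext fun i => by simpa using hc i)
      exact Finset.prod_eq_zero (Finset.mem_univ i) (by simp [hi])
  · rw [if_neg (fun h => hx h.1)]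
    obtain ⟨i, hi⟩ : ∃ i, x i = true := by
      by_contra hc
      push Not at hc
      exact hx (funext fun i => by simpa using hc i)
    refine Finset.prod_eq_zero (Finset.mem_univ i) ?_
    cases hy : y i <;> simp [hi]

/-- **Non-vacuity**: the computational stabilizer frame `{Z^T}` of `|0ⁿ⟩` (all signs `+1`).
[cite: NielsenChuang2010, §10.5.1] -/
def zeroFrame (n : ℕ) : StabFrame (zeroKet n) where
  word := zWord
  sign := fun _ => 1
  word_injective := zWord_injective
  word_zero := by funext i; simp [zWord, idWord]
  norm_sign_le := fun _ => by simp
  frame := by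
    intro x y
    simp_rw [one_mul]
    rw [sum_pauliString_zWord]
    unfold zeroKet
    by_cases hx : x = fun _ => false <;> by_cases hy : y = fun _ => false <;> simp [hx, hy]

/-- `|0ⁿ⟩` is a unit vector. [cite: NielsenChuang2010, §10.5.1] -/
theorem normSq_zeroKet (n : ℕ) : normSq (zeroKet n) = 1 := by
  unfold normSq zeroKet
  rw [Finset.sum_eq_single (fun _ => false)]
  · simp
  · intro x _ hx; simp [hx]
  · intro h; exact absurd (Finset.mem_univ _) h

end Literature.Computability.QuantumComplexity.PauliMoments

end
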